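import Summits.BirchSwinnertonDyer.BirchSwinnertonDyer.Theses.CongruentShaFreeCut
import Summits.BirchSwinnertonDyer.BirchSwinnertonDyer.Theorems.CongruentShaFreeCutTwoAdicBDPExistsValueUpToResidual

set_option linter.dupNamespace false

/-! # BC3 skeleton PROPOSAL — crux `RankPosOfTwoSelmerCorankOne` (route `CongruentShaFreeCut`, rung S2;
stmt-BirchSwinnertonDyer-19079, the route's declared RESIDUAL crux A), line `heegner-field-bdp-triple-upto`,
**version v6cq** — written by the prover seat `bsd-cn100-transfer` (g11) for the PLAN seat to register (plan g15
RULING 2026-08-27T00:41:17Z (4)); this seat does not `crux write`.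

**v6cq = v6cp (c1b04d14a1c8a32b) with the ♯ PAIR {`stub_twoAdicBDPElementExistsUpTo`, `stub_twoAdicBDPValueAtOneUpTo`}
REPLACED BY THE ONE ∃∧ STUB `stub_twoAdicBDPElementExistsWithValueUpTo : TwoAdicBDPElementExistsWithValueUpTo`**
(the LANDED `@[conjecture] def` of `Theorems/CongruentShaFreeCutTwoAdicBDPExistsValueUpTo.lean`, p478969: ONE admissible
tuple `(ι', Ω_K, Ω_p, C, 𝓛)` with `IsBDPLFunctionUpTo C ι' v κ γ Dt.f Ω_K Ω_p 𝓛` AND its value at `𝟙` — WEAKER than the pair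
by the landed calibration `bdpExistsWithValueUpTo_of_exists_of_value`, = exactly what MEMO-transfer-13 Thm 13.1 + (5.3.1)
write, and SUFFICIENT: the composition below runs through the LANDED residual census
`…CongruentShaFreeCutTwoAdicBDPExistsValueUpTo.cruxA_of_res_of_bdpExistsValueUpTo` (p479460; Link A in corank form from (res)
with Poitou–Tate DISCHARGED, `CongruentShaFreeCutCensusPTFree.twoAdicControlOfCorankOne_of_res_ptFree`, p457436), so v6cp's
in-skeleton glue `twoAdicControlOfCorankOne_of_res_imaginaryQuadratic` is no longer needed and is dropped).
`stub_refereedInputs` (5 conjuncts), `stub_twoLocNonDegeneracy`, `stub_twoAdicWanDivisibilityUpTo` are TOKEN-IDENTICAL with v6cp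
(nothing else expires; the ∀-form `TwoAdicBDPValueAtOneUpTo` and the bare (LB-exist♯) stay LANDED as settled shape-knowledge:
∀-form ⟸ ∃∧-at-every-ι′ by LEMMA R p477603/p478135 + the character-supply THEOREM `CongruentShaFreeCutCharacterSupply.characterSupplyAt`;
∃∧ ⟸ pair by the calibration). Sorries 4 = the 4 stubs. HONESTY: nothing about BSD, the leaf or crux A is proved here.
PARTITION: none (RANK axis). -/

noncomputable section

open scoped Classical

namespace Summit.BirchSwinnertonDyer.BirchSwinnertonDyer.Cruxes.RankPosOfTwoSelmerCorankOne.HeegnerFieldBDPTripleUpTo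

open PowerSeries WeierstrassCurve NumberField IsDedekindDomain Field Literature.NumberTheory.EllipticCurves
  Literature.NumberTheory.EllipticCurves.ModularForms Literature.NumberTheory.QuadraticFields
  Literature.NumberTheory.EllipticCurves.Castella2018
open Summit.BirchSwinnertonDyer.BirchSwinnertonDyer.Theses.CongruentShaFreeCut
open Literature.NumberTheory.GaloisRepresentations Literature.NumberTheory.GaloisCohomology
open Summit.BirchSwinnertonDyer.BirchSwinnertonDyer.Theorems.CongruentShaFreeCutTwoAdicBDPTripleUpTo
  (TwoAdicWanDivisibilityUpTo)
open Summit.BirchSwinnertonDyer.BirchSwinnertonDyer.Theorems.CongruentShaFreeCutTwoAdicBDPExistsValueUpTo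
  (TwoAdicBDPElementExistsWithValueUpTo cruxA_of_res_of_bdpExistsValueUpTo)

/-- **stub_refereedInputs** (size S, CITATION-BORNE; token-identical with v6b/v6c/v6cp): `2`-parity, modularity,
Hoffstein–Luo, Kato, existence of Heegner points. [cite: DokchitserDokchitserAnnals2010, Thm. 1.4]
[cite: Kato2004, Cor. 14.3] [cite: Gross1984, §§3–4] -/
theorem stub_refereedInputs :
    (∀ (W : WeierstrassCurve ℚ) [W.IsElliptic] (p : ℕ) [Fact p.Prime], p_parity W p) ∧
    ModularForms.exists_isNewformOf ∧
    HoffsteinLuo1997_exists_twist_L_one_ne_zero ∧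
    (∀ (W : WeierstrassCurve ℚ) [W.IsElliptic] (p : ℕ) [Fact p.Prime],
      kato_finite_of_L_one_ne_zero W p) ∧
    (∀ (W : WeierstrassCurve ℚ) (K : Type) [Field K] [NumberField K], exists_isHeegnerPoint W K) := by
  sorry

/-- **stub_twoLocNonDegeneracy** (size XL, OPEN — (res) at the additive prime `2`; token-identical with
v4/v5/v6b/v6c/v6cp). [cite: Skinner2020, Thm. B and §2.2 (shape of the hypothesis; nothing asserted)]
[cite: WZhang2014, Thm. 1.3 and Remark 2 (p. 198)] -/
theorem stub_twoLocNonDegeneracy :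
    ∀ ⦃n : ℕ⦄, Squarefree n → ∀ (K : Type) [Field K] [NumberField K],
      IsImaginaryQuadratic K → SatisfiesHeegnerHypothesis 2 K →
        ((congruentNumberCurve n).baseChange K).selmerCorank 2 = 1 →
      ∀ (w : HeightOneSpectrum (𝓞 K)), ((2 : ℕ) : 𝓞 K) ∈ w.asIdeal →
        Finite ↥(((congruentNumberCurve n).baseChange K).selmerGroupPInfty 2 ⊓
          selmerLocalKerPrimaryTorsion ((congruentNumberCurve n).baseChange K) (w.adicCompletion K) 2) := by
  sorry

/-- **stub_twoAdicBDPElementExistsWithValueUpTo** (size XL, OPEN — (LB-exist∧bdp♯)∃: ONE `2`-adic anticyclotomic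
BDP tuple up to a nonzero constant WITH its value at the trivial character; the research CONSTRUCTION at the
additive prime `2`, MEMO-transfer-13 Thm 13.1 + (5.3.1) shape; replaces the v6cp pair
`stub_twoAdicBDPElementExistsUpTo` + `stub_twoAdicBDPValueAtOneUpTo`). [cite: Castella2018, Thm. 3.1 and Thm. 3.2 (shape)]
[cite: BertoliniDarmonPrasanna2013, Thm. 5.13 (shape)] [cite: CastellaHsieh2018, Prop. 3.4 and Prop. 3.6 (shape; the constant)] -/
theorem stub_twoAdicBDPElementExistsWithValueUpTo : TwoAdicBDPElementExistsWithValueUpTo := by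
  sorry

/-- **stub_twoAdicWanDivisibilityUpTo** (size XL, OPEN; token-identical with v6c/v6cp): (LB-wan♯).
[cite: CastellaGrossiLeeSkinner2022, Thm. 4.2.2 (shape of the other divisibility)] -/
theorem stub_twoAdicWanDivisibilityUpTo : TwoAdicWanDivisibilityUpTo := by
  sorry

/-- The skeleton composition (v6cq): crux A by the LANDED folded-currency residual census
`…CongruentShaFreeCutTwoAdicBDPExistsValueUpTo.cruxA_of_res_of_bdpExistsValueUpTo` (p479460: the five refereed facts,
(res) = `stub_twoLocNonDegeneracy`, the ∃∧ stub, (LB-wan♯); Link A in corank form and Poitou–Tate are tree theorems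
inside it) — the only theorem of this file concluding the crux by name. -/
theorem RankPosOfTwoSelmerCorankOne_of_stubs : RankPosOfTwoSelmerCorankOne :=
  cruxA_of_res_of_bdpExistsValueUpTo
    stub_refereedInputs.1 stub_refereedInputs.2.1 stub_refereedInputs.2.2.1 stub_refereedInputs.2.2.2.1
    stub_refereedInputs.2.2.2.2 stub_twoLocNonDegeneracy stub_twoAdicBDPElementExistsWithValueUpTo
    stub_twoAdicWanDivisibilityUpTo

end Summit.BirchSwinnertonDyer.BirchSwinnertonDyer.Cruxes.RankPosOfTwoSelmerCorankOne.HeegnerFieldBDPTripleUpTo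

end
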